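import Summits.BirchSwinnertonDyer.BirchSwinnertonDyer.Theses.TameQuarticManinParity
import Literature.NumberTheory.ModularSymbols.CuspidalHomologyShiftNorm
import HarnessLib

/-!
# Route `TameQuarticManinParity`: H2 `TprimeIrrPrymDefectAvoidsThree` (stmt-BirchSwinnertonDyer-23480) from
# E30 `PrymDefectHeckeEisensteinSplit` (stmt-23597) and B30 `IrrModThreeSplitTraceWitness` (stmt-23598), BY NAME

Lead seat `cruxlead-stmt-BirchSwinnertonDyer-23367` g0, line `abelian-fixed-points`; the pen bsd-idea-3 g9's LINE 30
split of H2 (their scratch `LINE30_H2_of.lean` is kernel-checked but not landable by a planner; this is the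
LEAD's own kernel copy). THEOREMS ONLY: no definition, no named fact, no `sorry`, no Galois structure.

## Content

* `T_sub_pow_smul_sub_zsmul_mem_shiftSubOneLattice` — if `T_p ≡ 2` on `Λ_P/Λ₁` (E30 at the prime `p`) then
  `(T_p − a)^k y ≡ (2 − a)^k y (mod Λ₁)` for every `y ∈ Λ_P`, `a ∈ ℤ`, `k`;
* `prymDefectAvoidsThree_of_eisensteinSplit_of_traceWitness` : E30 → B30 → H2: take `S = {p}` with B30's prime
  `p ≡ 1 (mod N_W)`, `a_p(W) ≢ 2 (mod 3)`; if `(T_p − a_p)^k y ∈ Λ₁` then `(2 − a_p)^k y ∈ Λ₁`, and since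
  `3 y ∈ Λ₁` (`3Λ_P ⊆ Λ₁`) and `gcd((2 − a_p)^k, 3) = 1`, Bézout gives `y ∈ Λ₁`.

CREDIT RULE: GLUE. H2 stays open (its content is E30 ∧ B30); no summit is proved; BSD is NOT proved by this file.
-/

set_option autoImplicit false
-- D-0017: single-problem summit, so `Summit.BirchSwinnertonDyer.BirchSwinnertonDyer.…` repeats a namespace BY DESIGN.
set_option linter.dupNamespace false

noncomputable section

namespace Summit.BirchSwinnertonDyer.BirchSwinnertonDyer.Theorems.TameQuarticManinParity

open Literature.NumberTheory.EllipticCurves Literature.NumberTheory.EllipticCurves.ModularForms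
  Literature.NumberTheory.ModularSymbols
  Summit.BirchSwinnertonDyer.BirchSwinnertonDyer.Theses.TameQuarticManinParity

section Lattice

variable {N : ℕ} [NeZero N] (h9 : 3 ^ 2 ∣ N)

/-- **`(T_p − a)^k y ≡ (2 − a)^k y (mod Λ₁)` on `Λ_P` when `T_p ≡ 2` there**: if `(T_p − 2)Λ_P ⊆ Λ₁` then for
every `y ∈ Λ_P`, `a ∈ ℤ`, `k ∈ ℕ`: `(T_p − a)^k • y − (2 − a)^k • y ∈ Λ₁` (induction on `k`; `Λ_P` is
`T_p`-stable, `Λ₁` a `ℤ`-submodule). [folklore] -/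
theorem T_sub_pow_smul_sub_zsmul_mem_shiftSubOneLattice {p : ℕ} (hp : p.Prime) (hp3 : p ≠ 3)
    (hE : ∀ y ∈ prymLattice N h9,
      (HeckeRing0.T N 2 p hp - (2 : HeckeRing0 N 2)) • y ∈ shiftSubOneLattice N h9)
    (a : ℤ) (k : ℕ) {y : periodHomologyHecke N} (hy : y ∈ prymLattice N h9) :
    (HeckeRing0.T N 2 p hp - (a : HeckeRing0 N 2)) ^ k • y - ((2 - a) ^ k : ℤ) • y ∈
      shiftSubOneLattice N h9 := by
  induction k with
  | zero =>
    rw [pow_zero, pow_zero, one_smul, one_smul, sub_self]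
    exact Submodule.zero_mem _
  | succ k ih =>
    -- `z := (T − a)^k y ∈ Λ_P`
    have hz : (HeckeRing0.T N 2 p hp - (a : HeckeRing0 N 2)) ^ k • y ∈ prymLattice N h9 := by
      clear ih
      induction k with
      | zero => rwa [pow_zero, one_smul]
      | succ k ih' =>
        rw [pow_succ', mul_smul, sub_smul, Int.cast_smul_eq_zsmul]
        exact Submodule.sub_mem _ (T_smul_mem_prymLattice h9 hp hp3 ih') (Submodule.smul_mem _ _ ih')
    set z := (HeckeRing0.T N 2 p hp - (a : HeckeRing0 N 2)) ^ k • y with hzdef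
    -- `(T − a) z = (T − 2) z + (2 − a) z`
    have h2 : ((2 : HeckeRing0 N 2)) • z = (2 : ℤ) • z := by
      rw [two_smul, two_smul]
    have hsplit : (HeckeRing0.T N 2 p hp - (a : HeckeRing0 N 2)) • z =
        (HeckeRing0.T N 2 p hp - (2 : HeckeRing0 N 2)) • z + ((2 - a : ℤ)) • z := by
      rw [sub_smul (HeckeRing0.T N 2 p hp) (a : HeckeRing0 N 2) z, Int.cast_smul_eq_zsmul,
        sub_smul (HeckeRing0.T N 2 p hp) (2 : HeckeRing0 N 2) z, h2, sub_smul (2 : ℤ) a z]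
      abel
    rw [pow_succ', mul_smul, ← hzdef, hsplit, pow_succ', mul_smul]
    -- `= (T − 2) z + (2 − a) • (z − (2 − a)^k y)`, both in `Λ₁`
    have e : (HeckeRing0.T N 2 p hp - (2 : HeckeRing0 N 2)) • z + (2 - a : ℤ) • z -
        (2 - a : ℤ) • (((2 - a) ^ k : ℤ) • y) =
        (HeckeRing0.T N 2 p hp - (2 : HeckeRing0 N 2)) • z + (2 - a : ℤ) • (z - ((2 - a) ^ k : ℤ) • y) := by
      rw [smul_sub]
      abel
    rw [e]
    exact Submodule.add_mem _ (hE z hz) (Submodule.smul_mem _ _ ih)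

end Lattice

/-- **H2 ⟸ E30 ∧ B30** (`TprimeIrrPrymDefectAvoidsThree`, stmt-BirchSwinnertonDyer-23480, from
`PrymDefectHeckeEisensteinSplit`, stmt-23597, and `IrrModThreeSplitTraceWitness`, stmt-23598): with B30's prime
`p ≡ 1 (mod N_W)`, `p ≠ 3`, `a_p(W) ≢ 2 (mod 3)`, take `S = {p}`; E30 gives `T_p ≡ 2` on `Λ_P/Λ₁`, so
`(T_p − a_p)^k y ∈ Λ₁` forces `(2 − a_p)^k y ∈ Λ₁`; with `3y ∈ Λ₁` and `gcd((2 − a_p)^k, 3) = 1`, Bézout gives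
`y ∈ Λ₁`. Glue only: H2 remains open (its content is E30 ∧ B30); BSD is not proved by this. [folklore] -/
theorem prymDefectAvoidsThree_of_eisensteinSplit_of_traceWitness
    (hE : PrymDefectHeckeEisensteinSplit) (hB : IrrModThreeSplitTraceWitness) :
    TprimeIrrPrymDefectAvoidsThree := by
  intro W _ _ _ hCM hA hS hirr hv h9
  obtain ⟨p, hp, hp3, hp1, hnd⟩ := hB W hirr
  refine ⟨{p}, fun y hy hgen ↦ ?_⟩
  obtain ⟨k, hk⟩ := hgen p hp hp3 (Finset.mem_singleton_self p)
  -- E30 at level `N_W` and the prime `p`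
  have hE' : ∀ y' ∈ prymLattice (W.conductorNorm ℤ) h9,
      (HeckeRing0.T (W.conductorNorm ℤ) 2 p hp - (2 : HeckeRing0 (W.conductorNorm ℤ) 2)) • y' ∈
        shiftSubOneLattice (W.conductorNorm ℤ) h9 :=
    fun y' hy' ↦ hE (W.conductorNorm ℤ) h9 p hp hp3 hp1 y' hy'
  -- `(2 − a_p)^k • y ∈ Λ₁`
  have hc : ((2 - W.LFunction p) ^ k : ℤ) • y ∈ shiftSubOneLattice (W.conductorNorm ℤ) h9 := by
    have h := T_sub_pow_smul_sub_zsmul_mem_shiftSubOneLattice h9 hp hp3 hE' (W.LFunction p) k hy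
    have e : ((2 - W.LFunction p) ^ k : ℤ) • y =
        (HeckeRing0.T (W.conductorNorm ℤ) 2 p hp - (W.LFunction p : HeckeRing0 (W.conductorNorm ℤ) 2)) ^ k • y -
          ((HeckeRing0.T (W.conductorNorm ℤ) 2 p hp - (W.LFunction p : HeckeRing0 (W.conductorNorm ℤ) 2)) ^ k • y -
            ((2 - W.LFunction p) ^ k : ℤ) • y) := by
      abel
    rw [e]
    exact Submodule.sub_mem _ hk h
  -- `3 • y ∈ Λ₁`
  have h3 : (3 : ℤ) • y ∈ shiftSubOneLattice (W.conductorNorm ℤ) h9 := by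
    have h := three_smul_mem_shiftSubOneLattice (W.conductorNorm ℤ) h9 hy
    rwa [← Nat.cast_smul_eq_nsmul ℤ, Nat.cast_ofNat] at h
  -- Bézout: `gcd((2 − a_p)^k, 3) = 1`
  have hcop : IsCoprime ((2 - W.LFunction p) ^ k) (3 : ℤ) := by
    refine IsCoprime.pow_left (IsCoprime.symm ((Int.prime_three.coprime_iff_not_dvd).mpr fun h ↦ hnd ?_))
    have h' := dvd_neg.mpr h
    rwa [neg_sub] at h'
  obtain ⟨u, v, huv⟩ := hcop
  have ey : y = u • (((2 - W.LFunction p) ^ k : ℤ) • y) + v • ((3 : ℤ) • y) := by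
    rw [smul_smul, smul_smul, ← add_smul, huv, one_smul]
  rw [ey]
  exact Submodule.add_mem _ (Submodule.smul_mem _ _ hc) (Submodule.smul_mem _ _ h3)

end Summit.BirchSwinnertonDyer.BirchSwinnertonDyer.Theorems.TameQuarticManinParity

end
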